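import Literature.AlgebraicGeometry.Resolution.ArithmeticalThreefolds
import Literature.AlgebraicGeometry.Resolution.KollarBlowupSequenceFunctorsProofs
import HarnessLib

/-!
# `CossartPiltant2019`: the characteristic-zero half is a theorem; what remains is `char k = p > 0`

Topic: `Literature/AlgebraicGeometry/Resolution`. Proofs only (no new notions, no new named
facts). The named fact `CossartPiltant2019` (`ResolutionOfSingularities.lean`: every reduced
separated scheme of finite type and dimension `≤ 3` over a field `k` — of ANY characteristic — has
a resolution of singularities) quantifies over all fields. Since `Hironaka1964_holds`
(`KollarBlowupSequenceFunctorsProofs.lean`, Kollár 2007 Ch. 3) is now a theorem of the tree, the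
fields of characteristic `0` are settled in every dimension, and the open content of
`CossartPiltant2019` is exactly its restriction to fields of prime characteristic — the case
Cossart–Piltant's Thm. 1.1 is cited for (CP 2019, proof of Prop. 4.10 (arXiv v1: Prop. 4.8), first
paragraph: "the equicharacteristic zero version of theorem 1.1 being known").

* `resolutionOverUpToDim_of_charP_zero`, `resolutionOverUpToDim_of_charZero` — PROVED:
  `ResolutionOverUpToDim k d` for every field `k` of characteristic `0` and every `d`;
* `cossartPiltant2019_of_primeChar`, `cossartPiltant2019_iff_primeChar` — PROVED:
  `CossartPiltant2019 ↔ ∀ p prime, ∀ k of characteristic p, ResolutionOverUpToDim k 3`;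
* `cossartPiltant2019_of_resolutionOfSingularities` — PROVED: in universe `0` the summit
  conjunct `ResolutionOfSingularities` implies `CossartPiltant2019` (the fact is a known case of
  the summit statement, not an extra hypothesis of it).

Discharge status of `CossartPiltant2019` itself (review 2026-08-15): it is the one-liner
`CossartPiltant2019General_holds.cossartPiltant2019'` (`ResolutionOfSingularitiesProofs.lean`)
from Thm. 1.1 as printed (`CossartPiltant2019General`, `QuasiExcellentSchemes.lean`), or
`cossartPiltant2019_leaves` (`ArithmeticalThreefoldsLocal.lean`) from the six leaves of the
paper's own architecture; none of those named facts is discharged yet.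

## Sources

* V. Cossart, O. Piltant, *Resolution of singularities of arithmetical threefolds*, J. Algebra
  529 (2019) 268–535 (= arXiv:1412.0868), Thm. 1.1 (p. 3) and proof of Prop. 4.10 (v1: 4.8).
  [CossartPiltant2019]
* H. Hironaka, Ann. of Math. 79 (1964), Main Theorem I; J. Kollár, *Lectures on Resolution of
  Singularities*, PUP 2007, Thm. 3.36. [Hironaka1964] [Kollar2007]
-/

noncomputable section

open CategoryTheory AlgebraicGeometry

namespace Literature.AlgebraicGeometry.Resolution

universe u

/-- **Characteristic zero, every dimension**: over a field of characteristic `0` every reduced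
separated scheme of finite type has a resolution (`Hironaka1964_holds`), in particular
`ResolutionOverUpToDim k d` for every `d`. [cite: Kollar2007, Thm. 3.36] -/
theorem resolutionOverUpToDim_of_charP_zero (k : Type u) [Field k] [CharP k 0] (d : ℕ) :
    ResolutionOverUpToDim k d :=
  fun X f hs hl hq hr _ => Hironaka1964_holds k X f hs hl hq hr

/-- The same for `CharZero` fields. [cite: Kollar2007, Thm. 3.36] -/
theorem resolutionOverUpToDim_of_charZero (k : Type u) [Field k] [CharZero k] (d : ℕ) :
    ResolutionOverUpToDim k d :=
  resolutionOverUpToDim_of_charP_zero k d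

/-- **`CossartPiltant2019` from its prime-characteristic case**: resolution of reduced separated
threefolds of finite type over every field of prime characteristic gives `CossartPiltant2019`,
the characteristic-zero fields being covered by `Hironaka1964_holds`.
[cite: CossartPiltant2019, Thm. 1.1 and proof of Prop. 4.10 (arXiv v1: Prop. 4.8)] -/
theorem cossartPiltant2019_of_primeChar
    (h : ∀ p : ℕ, p.Prime → ∀ (k : Type u) [Field k] [CharP k p], ResolutionOverUpToDim k 3) :
    CossartPiltant2019.{u} := by
  refine cossartPiltant2019_iff.mpr fun k _ => ?_
  obtain ⟨p, hp⟩ := CharP.exists k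
  rcases CharP.char_is_prime_or_zero k p with hprime | rfl
  · exact h p hprime k
  · exact resolutionOverUpToDim_of_charP_zero k 3

/-- **What remains of `CossartPiltant2019` is exactly prime characteristic**:
`CossartPiltant2019 ↔ ∀ p prime, ∀ k with char k = p, ResolutionOverUpToDim k 3`.
[cite: CossartPiltant2019, Thm. 1.1] -/
theorem cossartPiltant2019_iff_primeChar :
    CossartPiltant2019.{u} ↔
      ∀ p : ℕ, p.Prime → ∀ (k : Type u) [Field k] [CharP k p], ResolutionOverUpToDim k 3 :=
  ⟨fun h _p _ k _ _ => cossartPiltant2019_iff.mp h k, cossartPiltant2019_of_primeChar⟩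

/-- **`CossartPiltant2019` is a known case of the summit conjunct**: in universe `0`,
`ResolutionOfSingularities` (resolution over all fields of every prime characteristic, every
dimension) implies `CossartPiltant2019` — prime characteristic from the hypothesis,
characteristic zero from `Hironaka1964_holds`. [folklore] -/
theorem cossartPiltant2019_of_resolutionOfSingularities (h : ResolutionOfSingularities) :
    CossartPiltant2019.{0} :=
  cossartPiltant2019_of_primeChar fun p hp k _ _ X f hs hl hq hr _ => h p hp k X f hs hl hq hr

end Literature.AlgebraicGeometry.Resolution

end
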